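import Literature.ModelTheory.FiniteModelTheory.DegreeParitySystem
import Literature.ModelTheory.FiniteModelTheory.CFIUncolouredSeparatorProofs
import Literature.Computability.Complexity.GF2SolveProgram
import HarnessLib

/-!
# The degree-parity system is decided in polynomial time on adjacency codes

Topic `Literature/ModelTheory/FiniteModelTheory`; sequel of `DegreeParitySystem.lean`. The class
`paritySolvableClass = {⟨n, G⟩ | ParitySolvable G}` of finite graphs whose degree-parity system is
solvable over `𝔽₂` is isomorphism-closed (`isIsoClosed_paritySolvableClass`) and POLYNOMIAL-TIME
DECIDABLE: **`isPTIMEClass_paritySolvableClass`** (`IsPTIMEClass`, `CapturingPTIME.lean`: its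
language of adjacency codes is in the tree's `P`).

The decision procedure is a first-order functional program on adjacency codes — the augmented rows
`rowL` of the system (`rowsL`: one row per vertex of degree `2` or `3`, coefficients the adjacency
indicator, right-hand side `[deg = 2]`) fed to the Gaussian-elimination program `GF2Solve.progS` of
`GF2SolveProgram.lean` — assembled in the typed `FP` algebra `CodeFP` (`TwoColouring.adjFP`,
`CFISep.degFP`, `map`/`filter`), and shown to compute `ParitySolvable (TwoColouring.graph n bits)`
(`decideL_eq_true_iff`); then, as for `CFISep.isPTIMEClass_cfiSeparatingClass`, a string is the code
of a member iff re-encoding the graph read off it returns it and the program accepts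
(`BGS.Sim.mem_graphClassLanguage_iff`).

## References

* A. Atserias, A. Bulatov, A. Dawar, *Affine systems of equations and counting infinitary logic*,
  Theoret. Comput. Sci. 410 (2009), §1 ("solvability of systems of linear equations … is in
  polynomial time by Gaussian elimination") [AtseriasBulatovDawar2009].
* S. Arora, B. Barak, *Computational Complexity: A Modern Approach*, CUP 2009, §1.3
  [AroraBarak2009].
-/

noncomputable section

namespace Literature.ModelTheory.FiniteModelTheory

open Finset Literature.Computability.Complexity Literature.Computability.Complexity.CodeFP
  Literature.Computability.Complexity.TwoColouring Literature.Computability.Complexity.GF2Kernel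
  Literature.Computability.Complexity.GF2Solve

namespace ParityFP

/-! ### The program -/

section Program

variable (n : ℕ) (bits : List Bool)

/-- Vertex `z` carries an equation: its degree is `2` or `3`. [folklore] -/
def isEqVertex (z : ℕ) : Bool := decide (CFISep.deg n bits z = 2) || decide (CFISep.deg n bits z = 3)

/-- **The augmented row of vertex `z`**: the adjacency indicator of `z` over `0, …, n-1`, then the
right-hand side `[deg z = 2]`. [folklore] -/
def rowL (z : ℕ) : List Bool := (List.range n).map (adj n bits z) ++ [decide (CFISep.deg n bits z = 2)]

/-- **The augmented rows of the degree-parity system** of the graph coded by `(n, bits)`. [folklore] -/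
def rowsL : List (List Bool) := ((List.range n).filter (isEqVertex n bits)).map (rowL n bits)

/-- **The decision procedure**: Gaussian elimination on the augmented rows. [folklore] -/
def decideL : Bool := progS (rowsL n bits)

/-- Rows have length `n + 1`. [folklore] -/
theorem length_rowL (z : ℕ) : (rowL n bits z).length = n + 1 := by simp [rowL]

end Program

/-! ### The program decides `ParitySolvable` -/

section Agree

variable (n : ℕ) (bits : List Bool)

local notation "Z" => TwoColouring.graph n bits

/-- `dotB` splits over appended singletons. [folklore] -/
theorem dotB_append_singleton : ∀ (l₁ l₂ : List Bool) (c d : Bool), l₁.length = l₂.length →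
    dotB (l₁ ++ [c]) (l₂ ++ [d]) = xor (dotB l₁ l₂) (c && d)
  | [], [], c, d, _ => by cases c <;> cases d <;> rfl
  | a :: l₁, b :: l₂, c, d, h => by
    rw [List.cons_append, List.cons_append, dotB_cons_cons, dotB_cons_cons,
      dotB_append_singleton l₁ l₂ c d (by simpa using h)]
    cases a <;> cases b <;> cases dotB l₁ l₂ <;> cases c <;> cases d <;> rfl
  | [], _ :: _, _, _, h => by simp at h
  | _ :: _, [], _, _, h => by simp at h

/-- A bit list of length `n` is the `ofFn` of its entries. [folklore] -/
theorem eq_ofFn_getD (x : List Bool) {n : ℕ} (hx : x.length = n) :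
    x = List.ofFn fun i : Fin n => x.getD i.val false := by
  apply List.ext_getElem (by simp [hx])
  intro i h₁ h₂
  simp [List.getD_eq_getElem?_getD, List.getElem?_eq_getElem h₁]

/-- The neighbourhood in the decoded graph is the filter by `adj`. [folklore] -/
theorem neighborFinset_eq_filter (z : Fin n) :
    (Z).neighborFinset z = Finset.univ.filter fun y : Fin n => adj n bits z.val y.val = true := by
  ext y
  rw [SimpleGraph.mem_neighborFinset, Finset.mem_filter, CFISep.adj_iff]
  simp

/-- **The dot product of the adjacency row with `x` is the parity of the marked neighbours.**
[folklore] -/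
theorem dotB_row_eq (z : Fin n) (x : List Bool) (hx : x.length = n) :
    dotB ((List.range n).map (adj n bits z.val)) x =
      !decide (Even ((Z).neighborFinset z |>.filter fun y => x.getD y.val false = true).card) := by
  have hfil : (Finset.univ.filter fun i : Fin n => (adj n bits z.val i.val && x.getD i.val false) = true) =
      ((Z).neighborFinset z).filter fun y => x.getD y.val false = true := by
    rw [neighborFinset_eq_filter, Finset.filter_filter]
    exact Finset.filter_congr fun y _ => Bool.and_eq_true_iff
  rw [← BGS.Sim.ofFn_eq_map_range n (adj n bits z.val), eq_ofFn_getD x hx, dotB_ofFn,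
    ← eq_ofFn_getD x hx, hfil]

/-- The indicator assignment of a bit list. [folklore] -/
def indic (x : List Bool) (y : Fin n) : ZMod 2 := if x.getD y.val false = true then 1 else 0

/-- **The neighbour sum of the indicator assignment is the parity of the marked neighbours.**
[folklore] -/
theorem sum_indic_eq (z : Fin n) (x : List Bool) :
    ∑ y ∈ (Z).neighborFinset z, indic n x y =
      (((Z).neighborFinset z).filter fun y => x.getD y.val false = true).card := by
  unfold indic
  rw [Finset.sum_boole]

/-- The two values of a residue mod `2`, by parity. [folklore] -/
theorem natCast_eq_one_of_not_even {k : ℕ} (he : ¬ Even k) : (k : ZMod 2) = 1 := by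
  rcases (by decide : ∀ a : ZMod 2, a = 0 ∨ a = 1) (k : ZMod 2) with h0 | h1
  · exact absurd (ZMod.natCast_eq_zero_iff_even.1 h0) he
  · exact h1

/-- **A row is satisfied by `x ++ [1]` iff the indicator assignment satisfies the vertex equation.**
[folklore] -/
theorem dotB_rowL_eq_false_iff (z : Fin n) (x : List Bool) (hx : x.length = n)
    (hz : (Z).degree z = 2 ∨ (Z).degree z = 3) :
    dotB (rowL n bits z.val) (x ++ [true]) = false ↔
      (((Z).degree z = 2 → ∑ y ∈ (Z).neighborFinset z, indic n x y = 1) ∧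
        ((Z).degree z = 3 → ∑ y ∈ (Z).neighborFinset z, indic n x y = 0)) := by
  rw [rowL, dotB_append_singleton _ _ _ _ (by simp [hx]), dotB_row_eq n bits z x hx, sum_indic_eq,
    ← CFISep.degree_eq, Bool.and_true]
  set k := (((Z).neighborFinset z).filter fun y => x.getD y.val false = true).card
  rcases hz with h2 | h3
  · by_cases he : Even k
    · have hk : (k : ZMod 2) = 0 := ZMod.natCast_eq_zero_iff_even.2 he
      simp [h2, he, hk]
    · have hk : (k : ZMod 2) = 1 := natCast_eq_one_of_not_even he
      simp [h2, he, hk]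
  · by_cases he : Even k
    · have hk : (k : ZMod 2) = 0 := ZMod.natCast_eq_zero_iff_even.2 he
      simp [h3, he, hk]
    · have hk : (k : ZMod 2) = 1 := natCast_eq_one_of_not_even he
      simp [h3, he, hk]

/-- Every assignment is the indicator of its bit list. [folklore] -/
theorem indic_ofFn (U : Fin n → ZMod 2) : indic n (List.ofFn fun i : Fin n => decide (U i = 1)) = U := by
  funext y
  unfold indic
  rw [List.getD_eq_getElem?_getD, List.getElem?_ofFn]
  simp only [Fin.is_lt, ↓reduceDIte, Fin.eta, Option.getD_some, decide_eq_true_eq]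
  rcases (by decide : ∀ a : ZMod 2, a = 0 ∨ a = 1) (U y) with h | h <;> simp [h]

/-- **The program decides solvability of the degree-parity system of the decoded graph.**
[cite: AtseriasBulatovDawar2009, §1 (Gaussian elimination)] -/
theorem decideL_eq_true_iff : decideL n bits = true ↔ ParitySolvable (Z) := by
  have hlen : ∀ r ∈ rowsL n bits, r.length = n + 1 := by
    intro r hr
    obtain ⟨z, -, rfl⟩ := List.mem_map.1 hr
    exact length_rowL n bits z
  rw [decideL, progS_eq_true_iff hlen, Solvable, ParitySolvable]
  have hmem : ∀ x : List Bool, (∀ r ∈ rowsL n bits, dotB r (x ++ [true]) = false) ↔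
      ∀ z : Fin n, ((Z).degree z = 2 ∨ (Z).degree z = 3) →
        dotB (rowL n bits z.val) (x ++ [true]) = false := by
    intro x
    constructor
    · intro h z hz
      apply h
      rw [rowsL, List.mem_map]
      refine ⟨z.val, List.mem_filter.2 ⟨List.mem_range.2 z.isLt, ?_⟩, rfl⟩
      rw [isEqVertex, Bool.or_eq_true, decide_eq_true_eq, decide_eq_true_eq, ← CFISep.degree_eq]
      exact hz
    · intro h r hr
      rw [rowsL, List.mem_map] at hr
      obtain ⟨z, hz, rfl⟩ := hr
      rw [List.mem_filter, List.mem_range] at hz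
      obtain ⟨hzn, hz⟩ := hz
      rw [isEqVertex, Bool.or_eq_true, decide_eq_true_eq, decide_eq_true_eq] at hz
      exact h ⟨z, hzn⟩ (by rwa [CFISep.degree_eq])
  constructor
  · rintro ⟨x, hx, hsol⟩
    refine ⟨indic n x, fun z => ?_⟩
    by_cases hz : (Z).degree z = 2 ∨ (Z).degree z = 3
    · exact (dotB_rowL_eq_false_iff n bits z x hx hz).1 ((hmem x).1 hsol z hz)
    · push Not at hz
      exact ⟨fun h => absurd h hz.1, fun h => absurd h hz.2⟩
  · rintro ⟨U, hU⟩
    refine ⟨List.ofFn fun i : Fin n => decide (U i = 1), List.length_ofFn, (hmem _).2 fun z hz => ?_⟩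
    rw [dotB_rowL_eq_false_iff n bits z _ List.length_ofFn hz, indic_ofFn]
    exact hU z

end Agree

/-! ### Polynomial time -/

section FP

/-- Context code: the graph `(n, bits)` and a vertex. [folklore] -/
abbrev c1E : (ℕ × List Bool) × ℕ → List Bool := pairE TwoColouring.mvE natE

/-- The adjacency row on codes. [folklore] -/
theorem adjRowFP : CodeFP c1E GF2Kernel.rowE (fun p => (List.range p.1.1).map (adj p.1.1 p.1.2 p.2)) := by
  have hg : CodeFP (pairE c1E natE) bitE (fun t => adj t.1.1.1 t.1.1.2 t.1.2 t.2) :=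
    (TwoColouring.adjFP.comp ((fst _ _).fst'.pair ((fst _ _).snd'.pair (snd _ _))) :)
  exact ((map hg).comp ((CodeFP.id c1E).pair (urange.comp (fst _ _).fst'))).congr fun _ => rfl

/-- The test "`deg = 2`" on codes. [folklore] -/
theorem degTwoFP : CodeFP c1E bitE (fun p => decide (CFISep.deg p.1.1 p.1.2 p.2 = 2)) :=
  (natEq.comp (CFISep.degFP.pair (const _ 2)) :)

/-- The test "`deg = 3`" on codes. [folklore] -/
theorem degThreeFP : CodeFP c1E bitE (fun p => decide (CFISep.deg p.1.1 p.1.2 p.2 = 3)) :=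
  (natEq.comp (CFISep.degFP.pair (const _ 3)) :)

/-- **The augmented row on codes.** [folklore] -/
theorem rowLFP : CodeFP c1E GF2Kernel.rowE (fun p => rowL p.1.1 p.1.2 p.2) :=
  (((rawAppend bitE).comp (adjRowFP.pair ((rawSingleton bitE).comp degTwoFP))).congr fun _ => rfl :)

/-- **The augmented rows on codes.** [folklore] -/
theorem rowsLFP : CodeFP TwoColouring.mvE GF2Kernel.rowsE (fun c => rowsL c.1 c.2) := by
  have hfil : CodeFP TwoColouring.mvE (rawE natE) (fun c => (List.range c.1).filter (isEqVertex c.1 c.2)) :=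
    ((filter (degTwoFP.or degThreeFP)).comp ((CodeFP.id _).pair (urange.comp (fst _ _)))).congr
      fun _ => rfl
  exact ((map rowLFP).comp ((CodeFP.id _).pair hfil)).congr fun _ => rfl

/-- **The decision procedure on codes.** [cite: AroraBarak2009, §1.3] -/
theorem decideLFP : CodeFP TwoColouring.mvE bitE (fun c => decideL c.1 c.2) :=
  (progSCode.comp rowsLFP).congr fun _ => rfl

end FP

/-! ### The class and its polynomial-time decidability -/

/-- **The class of finite graphs with solvable degree-parity system** (adjacency decided
classically; see `paritySolvable_congr_dec`). [cite: AtseriasBulatovDawar2009, §4] -/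
def paritySolvableClass : Set FinGraph :=
  {H | @ParitySolvable (Fin H.1) _ H.2 (Classical.decRel _)}

/-- Membership does not depend on the decidability instance. [folklore] -/
theorem mem_paritySolvableClass_iff {k : ℕ} (H : SimpleGraph (Fin k)) [DecidableRel H.Adj] :
    (⟨k, H⟩ : FinGraph) ∈ paritySolvableClass ↔ ParitySolvable H :=
  paritySolvable_congr_dec H _ _

/-- **The class is isomorphism-closed.** [folklore] -/
theorem isIsoClosed_paritySolvableClass : IsIsoClosed paritySolvableClass := by
  intro k k' G H ⟨e⟩
  classical
  rw [mem_paritySolvableClass_iff, mem_paritySolvableClass_iff]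
  exact paritySolvable_iff_of_iso e

/-- **Membership of a decoded graph is the program's answer.** [folklore] -/
theorem mem_paritySolvableClass_graph_iff (n : ℕ) (v : List Bool) :
    (⟨n, TwoColouring.graph n v⟩ : FinGraph) ∈ paritySolvableClass ↔ decideL n v = true := by
  rw [mem_paritySolvableClass_iff, decideL_eq_true_iff]

/-- **The decision procedure on strings**: the code test and the program's answer. [folklore] -/
def decidePar (w : List Bool) : Bool :=
  decide (BGS.Sim.reencode (BGS.Sim.sizeOfCode w) (Brick.sndF w) = w) &&
    decideL (BGS.Sim.sizeOfCode w) (Brick.sndF w)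

/-- **The decision procedure is polynomial time on codes.** [cite: AroraBarak2009, §1.3] -/
theorem decideParFP : CodeFP strE bitE decidePar := by
  have hns : CodeFP strE TwoColouring.mvE (fun w => (BGS.Sim.sizeOfCode w, Brick.sndF w)) :=
    (BGS.Sim.sizeOfCodeFP.pair codeFP_hdrBody.snd' :)
  have htest : CodeFP strE bitE (fun w => decide (BGS.Sim.reencode (BGS.Sim.sizeOfCode w) (Brick.sndF w) = w)) :=
    ((CodeFP.eq (eα := strE) Function.injective_id).comp ((BGS.Sim.reencodeFP.comp hns).pair (CodeFP.id strE)) :)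
  exact (htest.and (decideLFP.comp hns)).congr fun w => rfl

/-- **The class of graphs with solvable degree-parity system is polynomial-time decidable**
(its language of adjacency codes is in the tree's `P`).
[cite: AtseriasBulatovDawar2009, §1 (solvability over 𝔽₂ is in P by Gaussian elimination)] -/
theorem isPTIMEClass_paritySolvableClass : IsPTIMEClass paritySolvableClass := by
  obtain ⟨g, hg, hge⟩ := decideParFP
  refine mem_P_of_mem_FP hg (graphClassLanguage paritySolvableClass) fun w => ?_
  have key : w ∈ graphClassLanguage paritySolvableClass ↔ decidePar w = true := by
    rw [BGS.Sim.mem_graphClassLanguage_iff, mem_paritySolvableClass_graph_iff, decidePar, Bool.and_eq_true,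
      decide_eq_true_eq]
  have hgw : g w = [decidePar w] := hge w
  constructor
  · intro hw; rw [hgw, key.mp hw]
  · intro hw
    rw [hgw]
    cases h : decidePar w
    · rfl
    · exact absurd (key.mpr h) hw

end ParityFP

end Literature.ModelTheory.FiniteModelTheory

end
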